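import Literature.AnabelianGeometry.EtaleTheta.RealifiedDivisorMonoidsOfRlf

/-!
# [EtTh] Definition 3.6 (i): the realified data CONSTRUCTED for the monoid type `Λ = ℚ`
# (`B₀^ℚ := B₀^pf`, `F₀^ℚ := F₀^pf`) — `RealifiedDivisorMonoids.ofRlfQ`

Mochizuki, *The étale theta function …*, Publ. RIMS **45** (2009), Def. 3.6 (i), PDF p.76 (printed
p.302) [cite: MochizukiEtTh2009, Def 3.6 p.76]: the display "`Φ₀^ℤ := Φ₀`; `Φ₀^ℚ := Φ₀^pf`;
`Φ₀^ℝ := Φ₀^rlf`; `B₀^ℤ := B₀`; `B₀^ℚ := B₀^pf`; `B₀^ℝ := ℝ·Φ₀^birat ⊆ (Φ₀^ℝ)^gp`; `F₀^ℤ := F₀`;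
`F₀^ℚ := F₀^pf`; `F₀^ℝ := ℝ·Φ₀^cnst ⊆ (Φ₀^ℝ)^gp` — where `Φ₀^rlf` is as in [Mzk17], Definition 2.4, (i)
[cf. Proposition 3.4, (i)]", together with the homomorphism `B₀^Λ → (Φ₀^ℝ)^gp` implicit in the fibre
products `B := B₀^Λ|_D ×_{(Φ^{ℝ-log})^gp} Φ^gp`, `F := F₀^Λ|_D ×_{(Φ^{ℝ-log})^gp} Φ^gp` of Def. 3.6 (ii)
(PDF p.77).  The perfection `M^pf` and its functoriality are [FrdI] §0 (kurims p.11)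
[cite: MochizukiFrdI2008, §0 p.11].

Sequel to `RealifiedDivisorMonoidsOfRlf.lean` (`ofRlfZ`) and `RealifiedDivisorMonoidsOfRlfR.lean`
(`ofRlfR`) (abc-iut cell ROW `EtTh:Def3.6(i) ofRlf`, seat abc-iut-L6-t12), completing the constructor
for the third monoid type: `B₀^ℚ := B₀^pf` (the perfection functor `perfectionFunctor B₀`),
`F₀^ℚ := F₀^pf` (the image of `F₀(Y)^pf → B₀(Y)^pf`), and `B₀^ℚ → (Φ₀^ℝ)^gp` the unique extension of the
`Λ = ℤ` map `B₀ → Φ₀^gp → (Φ₀^ℝ)^gp` to the perfection — it exists because `(Φ₀^rlf)^gp` is PERFECT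
(uniquely divisible: `(1/n) • x^n = x` for the `ℝ`-vector-space structure of [FrdI] Def. 2.4 (i)),
proved here as `RealificationDataLemmas.isPerfect_gp`, with the extension `Perfection.extend`
(`M^pf → Q^pf ≅ Q` for perfect `Q`).  Every field of abc-iut-L2-t3's `RealifiedDivisorMonoids` is
proved (naturality of `B₀^ℚ → (Φ₀^ℝ)^gp` by uniqueness of homomorphisms out of a perfection into a
perfect monoid; `F₀^pf ↦ ℝ·Φ₀^cnst` by the root-closedness of the span); only hypothesis:
Prop. 3.4 (i) (`Φ₀(Y)` perf-factorial).  `ℝ·Φ₀^cnst` and the (non-)cuspidal parts are those of `ofRlfZ`.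
-/

noncomputable section

namespace Literature.AnabelianGeometry.EtaleTheta

open CategoryTheory Opposite Literature.AlgebraicGeometry.Frobenioids

universe u v w

/-! ### `(Φ^rlf)^gp(X)` is perfect; the extension of a homomorphism to the perfection -/

namespace RealificationDataLemmas

variable {D : Type u} [Category.{v} D] {Φ : Dᵒᵖ ⥤ CommMonCat.{w}} (R : RealificationData Φ)

/-- **`(Φ^rlf)^gp(X)` is perfect** (every `n`-th power map, `n ≥ 1`, is bijective): injective since
`(1/n) • x^n = x`, surjective since `((1/n) • x)^n = x` — the `ℝ`-vector-space structure of
[FrdI] Def. 2.4 (i). [cite: MochizukiFrdI2008, Def. 2.4 (i) p.48] -/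
theorem isPerfect_gp (X : D) : IsPerfect (Algebra.GrothendieckGroup (R.rlf.obj (op X))) := by
  refine ⟨fun n hn => ⟨fun x y hxy => ?_, fun x => ⟨R.rsmul X ((n : ℝ)⁻¹) x, ?_⟩⟩⟩
  · have hx := R.rsmul_inv_natCast_pow X hn x
    have hy := R.rsmul_inv_natCast_pow X hn y
    rw [← hx, ← hy]
    exact congrArg _ hxy
  · change R.rsmul X ((n : ℝ)⁻¹) x ^ n = x
    rw [← R.rsmul_natCast X n, ← R.rsmul_mul,
      mul_inv_cancel₀ (Nat.cast_ne_zero.mpr hn.ne'), R.rsmul_one]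

end RealificationDataLemmas

/-- **Extension to the perfection**: a homomorphism `f : M → Q` into a PERFECT monoid `Q` extends to
`M^pf → Q`, namely `M^pf → Q^pf ≅ Q` (`Q → Q^pf` is bijective for perfect `Q`, [FrdI] §0).
[cite: MochizukiFrdI2008, §0 p.11] -/
def Perfection.extend {M : Type w} [CommMonoid M] {Q : Type w} [CommMonoid Q] (hQ : IsPerfect Q)
    (f : M →* Q) : Perfection M →* Q :=
  (MulEquiv.ofBijective (Perfection.of Q) (isPerfect_iff_bijective_of.mp hQ)).symm.toMonoidHom.comp
    (Perfection.map f)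

/-- The extension restricts to `f` on `M`. [cite: MochizukiFrdI2008, §0 p.11] -/
@[simp] theorem Perfection.extend_of {M : Type w} [CommMonoid M] {Q : Type w} [CommMonoid Q]
    (hQ : IsPerfect Q) (f : M →* Q) (a : M) : Perfection.extend hQ f (Perfection.of M a) = f a := by
  change (MulEquiv.ofBijective (Perfection.of Q) (isPerfect_iff_bijective_of.mp hQ)).symm
      (Perfection.map f (Perfection.of M a)) = f a
  rw [MulEquiv.symm_apply_eq]
  exact DFunLike.congr_fun (Perfection.map_comp_of f) a

/-- The extension as a composite: `extend ∘ of = f`. [cite: MochizukiFrdI2008, §0 p.11] -/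
theorem Perfection.extend_comp_of {M : Type w} [CommMonoid M] {Q : Type w} [CommMonoid Q]
    (hQ : IsPerfect Q) (f : M →* Q) : (Perfection.extend hQ f).comp (Perfection.of M) = f :=
  MonoidHom.ext (Perfection.extend_of hQ f)

namespace RealifiedDivisorMonoids

variable {D₀ : Type u} [Category.{v} D₀] (dm : DivisorMonoids.{u, v, w} D₀)
  (hpf : ∀ Y : D₀ᵒᵖ, IsPerfFactorial (dm.Φ₀.obj Y))

/-- `(Φ₀^ℝ)^gp(Y) = (Φ₀(Y)^rlf)^gp` is perfect. [cite: MochizukiEtTh2009, Def 3.6 p.76] -/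
theorem isPerfect_gp_rlf (Y : D₀ᵒᵖ) :
    IsPerfect (Algebra.GrothendieckGroup ((rlfFunctor dm.Φ₀ hpf).obj Y)) :=
  RealificationDataLemmas.isPerfect_gp (realData dm hpf) (unop Y)

/-- **`B₀^ℚ(Y) = B₀(Y)^pf → (Φ₀^ℝ)^gp(Y)`**: the extension to the perfection of
`B₀(Y) → Φ₀(Y)^gp → (Φ₀(Y)^rlf)^gp` (Def. 3.6 (i): "induced by `B₀ → Φ₀^gp`").
[cite: MochizukiEtTh2009, Def 3.6 p.76] -/
def divQ (Y : D₀ᵒᵖ) :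
    Perfection (dm.B₀.obj Y) →* Algebra.GrothendieckGroup ((rlfFunctor dm.Φ₀ hpf).obj Y) :=
  Perfection.extend (isPerfect_gp_rlf dm hpf Y) ((ofRlfZ dm hpf).divΛ Y)

/-- `divQ` restricts to the `Λ = ℤ` map `B₀ → (Φ₀^ℝ)^gp` on `B₀(Y)`. [cite: MochizukiEtTh2009, Def 3.6 p.76] -/
@[simp] theorem divQ_of (Y : D₀ᵒᵖ) (b : dm.B₀.obj Y) :
    divQ dm hpf Y (Perfection.of _ b) = (ofRlfZ dm hpf).divΛ Y b :=
  Perfection.extend_of _ _ b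

/-- **Definition 3.6 (i) for the monoid type `Λ = ℚ`, CONSTRUCTED**: as `ofRlfZ`, but with
`B₀^ℚ := B₀^pf` (the perfection functor), `F₀^ℚ := F₀^pf ⊆ B₀^pf` (the image of `F₀(Y)^pf`), and
`B₀^ℚ → (Φ₀^ℝ)^gp` the extension of `B₀ → (Φ₀^ℝ)^gp` to the perfection (target perfect); every axiom of
the interface is proved (naturality by uniqueness of maps out of a perfection into a perfect monoid;
`F₀^pf ↦ ℝ·Φ₀^cnst` by root-closedness of the span). [cite: MochizukiEtTh2009, Def 3.6 p.76] -/
def ofRlfQ : RealifiedDivisorMonoids (D₀ := D₀) treeMonoidVocab.{w} where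
  toDivisorMonoids := dm
  Λ := MonoidType.Q
  ΦR := rlfFunctor dm.Φ₀ hpf
  toR Y := ((toRlfNatTrans dm.Φ₀ hpf).app Y).hom
  toR_natural f x := (rlfMap_toRealification_of dm.Φ₀ hpf f x).symm
  isRealification Y := isRealificationVia_toRealification (hpf Y)
  BΛ := perfectionFunctor dm.B₀
  isUnit_BΛ Y b := by
    obtain ⟨⟨a, n⟩, rfl⟩ := Perfection.mk_surjective b
    change IsUnit (Perfection.mk a n)
    rw [← isUnit_pow_iff (PNat.ne_zero n), Perfection.mk_pow_self]
    exact (dm.isUnit_B₀ Y a).map (Perfection.of _)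
  divΛ Y := divQ dm hpf Y
  divΛ_natural {Y Y'} f b := by
    -- both sides are homomorphisms `B₀(Y)^pf → (Φ₀^ℝ)^gp(Y')` into a perfect monoid agreeing on `B₀(Y)`
    have key : (divQ dm hpf Y').comp (Perfection.map (dm.B₀.map f).hom) =
        (gpMap ((rlfFunctor dm.Φ₀ hpf).map f).hom).comp (divQ dm hpf Y) := by
      apply Perfection.hom_ext_of_isPerfect (isPerfect_gp_rlf dm hpf Y')
      ext a
      change divQ dm hpf Y' (Perfection.map (dm.B₀.map f).hom (Perfection.of _ a)) =
        gpMap ((rlfFunctor dm.Φ₀ hpf).map f).hom (divQ dm hpf Y (Perfection.of _ a))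
      rw [show Perfection.map (dm.B₀.map f).hom (Perfection.of _ a) = Perfection.of _ ((dm.B₀.map f).hom a)
        from rfl, divQ_of, divQ_of]
      exact (ofRlfZ dm hpf).divΛ_natural f a
    exact DFunLike.congr_fun key b
  FΛ Y := MonoidHom.mrange (Perfection.map (dm.F₀ Y).subtype)
  FΛ_map {Y Y'} f b hb := by
    obtain ⟨x, rfl⟩ := hb
    -- `B₀(f)^pf ∘ (F₀(Y) ⊆ B₀(Y))^pf = (F₀(Y') ⊆ B₀(Y'))^pf ∘ (F₀(f))^pf`
    let r : dm.F₀ Y →* dm.F₀ Y' :=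
      ((dm.B₀.map f).hom.comp (dm.F₀ Y).subtype).codRestrict (dm.F₀ Y') fun c => dm.F₀_map f c c.2
    refine ⟨Perfection.map r x, ?_⟩
    change Perfection.map (dm.F₀ Y').subtype (Perfection.map r x) =
      Perfection.map (dm.B₀.map f).hom (Perfection.map (dm.F₀ Y).subtype x)
    rw [← MonoidHom.comp_apply, ← Perfection.map_comp, ← MonoidHom.comp_apply, ← Perfection.map_comp]
    rfl
  cnstR Y := ((realData dm hpf).realSpan dm.cnstGp).carrier (unop Y)
  cnstR_map {Y Y'} f x hx := by
    have h := ((realData dm hpf).realSpan dm.cnstGp).pull_mem f.unop hx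
    rwa [pullGp, ← gpMap_eq_monGpMap] at h
  divΛ_mem_cnstR Y b hb := by
    obtain ⟨x, rfl⟩ := hb
    obtain ⟨⟨a, n⟩, rfl⟩ := Perfection.mk_surjective x
    -- `(divQ b)^n = divQ (of a) = ι(div₀ a) ∈ ℝ·Φ₀^cnst`, and the span is root-closed
    apply RealificationDataLemmas.mem_realSpan_of_pow_mem (realData dm hpf) dm.cnstGp (unop Y) n.pos
    change divQ dm hpf Y (Perfection.map (dm.F₀ Y).subtype (Perfection.mk a n)) ^ (n : ℕ) ∈ _
    rw [← map_pow, ← map_pow, Perfection.mk_pow_self, show Perfection.map (dm.F₀ Y).subtype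
      (Perfection.of _ a) = Perfection.of _ (a : dm.B₀.obj Y) from rfl, divQ_of]
    exact (ofRlfZ dm hpf).divΛ_mem_cnstR Y (a : dm.B₀.obj Y) a.2
  cnstR_root Y g n hg := RealificationDataLemmas.mem_realSpan_of_pow_mem _ _ (unop Y) n.pos hg
  cnst_le_cnstR Y b hb := (ofRlfZ dm hpf).cnst_le_cnstR Y b hb
  ncspR Y := rlfSuppIn (hpf Y) (toRSuppOf dm hpf Y (dm.ncsp₀ Y))
  cspR Y := rlfSuppIn (hpf Y) (toRSuppOf dm hpf Y (dm.csp₀ Y))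
  toR_ncsp Y x hx := supp_toR_subset_toRSuppOf dm hpf Y hx
  toR_csp Y x hx := supp_toR_subset_toRSuppOf dm hpf Y hx

/-- The monoid type of `ofRlfQ` is `ℚ`. [cite: MochizukiEtTh2009, Def 3.6 p.76] -/
@[simp] theorem ofRlfQ_Λ : (ofRlfQ dm hpf).Λ = MonoidType.Q := rfl

/-- `Φ₀^ℝ` of `ofRlfQ` is the realification functor. [cite: MochizukiEtTh2009, Def 3.6 p.76] -/
@[simp] theorem ofRlfQ_ΦR : (ofRlfQ dm hpf).ΦR = rlfFunctor dm.Φ₀ hpf := rfl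

/-- `B₀^ℚ := B₀^pf`. [cite: MochizukiEtTh2009, Def 3.6 p.76] -/
@[simp] theorem ofRlfQ_BΛ : (ofRlfQ dm hpf).BΛ = perfectionFunctor dm.B₀ := rfl

/-- `F₀^ℚ := F₀^pf` (the image of `F₀(Y)^pf → B₀(Y)^pf`). [cite: MochizukiEtTh2009, Def 3.6 p.76] -/
theorem ofRlfQ_FΛ (Y : D₀ᵒᵖ) :
    (ofRlfQ dm hpf).FΛ Y = MonoidHom.mrange (Perfection.map (dm.F₀ Y).subtype) := rfl

/-- `B₀^ℚ → (Φ₀^ℝ)^gp` of `ofRlfQ` is `divQ`. [cite: MochizukiEtTh2009, Def 3.6 p.76] -/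
theorem ofRlfQ_divΛ (Y : D₀ᵒᵖ) : (ofRlfQ dm hpf).divΛ Y = divQ dm hpf Y := rfl

/-- `ofRlfQ` shares `ℝ·Φ₀^cnst` and the (non-)cuspidal parts with `ofRlfZ`. [cite: MochizukiEtTh2009, Def 3.6 p.76] -/
theorem ofRlfQ_cnstR (Y : D₀ᵒᵖ) : (ofRlfQ dm hpf).cnstR Y = (ofRlfZ dm hpf).cnstR Y := rfl

/-- Same non-cuspidal parts as `ofRlfZ`. [cite: MochizukiEtTh2009, Def 3.6 p.77] -/
theorem ofRlfQ_ncspR (Y : D₀ᵒᵖ) : (ofRlfQ dm hpf).ncspR Y = (ofRlfZ dm hpf).ncspR Y := rfl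

/-- Same cuspidal parts as `ofRlfZ`. [cite: MochizukiEtTh2009, Def 3.6 p.77] -/
theorem ofRlfQ_cspR (Y : D₀ᵒᵖ) : (ofRlfQ dm hpf).cspR Y = (ofRlfZ dm hpf).cspR Y := rfl

end RealifiedDivisorMonoids

end Literature.AnabelianGeometry.EtaleTheta

end
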